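import Summits.QuantumFields.BalabanUV.Beta.FP.CoarseCovarianceInverseKernel
import Summits.QuantumFields.BalabanUV.Beta.FP.PerfectMaxwellDictMatrix
import Summits.QuantumFields.BalabanUV.Beta.FP.PerfectSymbol166StripReg
import Summits.QuantumFields.BalabanUV.Beta.FP.PerfectPropagatorKernelSymm
import Summits.QuantumFields.BalabanUV.Beta.GAN24.LatticeKernelReality
import Summits.QuantumFields.BalabanUV.Beta.GAN24.StripRegularRestrict

/-!
# `BalabanUV.Beta.FP.PerfectFeynmanSymbol` — road «FP» for binder row D1, sub-row **H2-P-INVKER** of H2-ASM-5a, part 1∕2: THE HOLOMORPHIC FEYNMAN ENTRY SYMBOL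
# `feynSym γ β := bondSymbol GsymInf γ β + (e^{ip_γ} − 1)(e^{−ip_β} − 1)` — strip regular on the (1.66) strip, EQUAL TO the owner's `feynMat (Re W_∞ s) (d1Sym s) γ β` on the
# real zone, INVERTED BY `symP` on the punctured zone ⟹ the lattice kernels of `Σ_γ symP α γ·feynSym γ β` and `Σ_γ feynSym α γ·symP γ β` are `[α = β]·δ`

HONEST DEPENDENCY (page 1, mandatory): continuum YM on T⁴ ⇐ BetaPertH ∧ nine spine estimates (0/9 proved); BetaPertH ⇐ (D1) ∧ (D4) ∧ CAP+tail;
G-an2-4 gates asym, D1 and NE2/3/4.  HONEST FRAMING (cell contract, verbatim): «discharging `BetaPertH` makes Bałaban's UV stability UNCONDITIONAL —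
a real constructive-QFT result; it is NOT the continuum limit and NOT the Clay problem.»  THIS MODULE DISCHARGES NOTHING of the wall: it is bookkeeping over the road's
own `k = ∞` objects BY NAME — `PerfectSymbolKMultiplierClosed.GsymInf`, `PerfectSymbol166StripReg.stripRegular_W166Inf` (beta-d1-formalise-leaf-01), `PerfectMaxwellDict(Matrix).bondSymbol` ∕
`bondSymbol_GsymInf_eq_maxwellMat` (H2-P-DICT), `PerfectPropagatorSymbol.PinfSym_mul_feynMat` ∕ `feynMat_mul_PinfSym` (H2-P-MAT), `PerfectPropagatorKernel.symP` ∕ `PinfKer` (H2-P-KER),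
`PerfectPropagatorKernelSymm.PinfSym_neg` ∕ `feynMat_star` (K4), `GAN24/LatticeKernelReality`, `GAN24/StripRegularRestrict.stripRegular_finset_sum`, and — for the
convolution of the `L¹` propagator kernel with the exponentially decaying Feynman kernel — beta-d1-formalise-leaf-06's `L¹` CONVOLUTION THEOREM
`FP/CoarseCovarianceInverseKernel.tsum_latticeKernel_mul_of_integrableOn(')` ∕ `summable_latticeKernel_mul_of_stripRegular` BY NAME (no second copy of that engine).
Two [our object] data definitions (`sliceSym`, `feynSym`); no `def … : Prop`; nothing cited; 0 sorry; 0∕4 row-D1 binders; NOT (P-INV) itself (part 3), NOT D1, NOT BetaPertH,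
NOT continuum, NOT Clay.  «not in print; our bookkeeping over the road's own `k = ∞` objects».  (Part 2∕2 = `FP/PerfectPropagatorInverse`: `MF`, `idF`, `comp Pker MF = idF = comp MF Pker`.)

ABSOLUTE RULE (cell charter, verbatim): «No internally-minted statement may enter as a cited fact. Every hypothesis is either kernel-proved in this package or a
verbatim quotation of a PUBLISHED theorem with page reference. The manuscript(s) under audit are NOT citable for their own disputed steps — they are the thing
under adjudication; programme-internal (2001/route/tribunal) claims are never citable.»

CONTENT (lattice dimension `d + 1`; `3 ≤ d + 1` where the propagator symbol's integrability is used).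
* §1 [folklore] corollaries of the tree's `L¹` convolution theorem in the TWO-POINT shape of `ExpKernelCalculus.comp`: `tsum_latticeKernel_mul_sub_of_integrable`
  (`Σ'_y K[P](y − x)·K[S](z − y) = K[P·S](z − x)`, `P` zone-integrable, `S` strip regular with `κ > 0`), the mirrored `tsum_latticeKernel_mul_sub_of_integrable'`, their
  summability, and the a.e. congruence `latticeKernel_congr_off_zero` (symbols agreeing on the PUNCTURED zone have the same kernel — `{0}` is Lebesgue-null).
* §2 [our object] `sliceSym γ β p := expFacPos γ p · expFacNeg β p` (the holomorphic `ξ = 1` slice entry), **`feynSym γ β := bondSymbol GsymInf γ β + sliceSym γ β`**;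
  `stripRegular_GsymInf` (`μ ≠ ν`, `0 ≤ κ ≤ κ₁₆₆(d+1)`), `exists_stripRegular_bondSymbol_GsymInf`, **`exists_stripRegular_feynSym`** (half-width `κ₁₆₆(d+1) > 0`, some bound `M ≥ 0`);
  **`feynSym_ofReal : feynSym γ β (ofRealVec s) = feynMat (Re W_∞(·,·;s)) (d1Sym s) γ β`** for `s ∈ BZ`; the punctured-zone identities **`sum_symP_mul_feynSym`**,
  **`sum_feynSym_mul_symP`** (`= [α = β]` for `s ∈ BZ`, `s ≠ 0`); conjugation symmetries `conj_symP_ofRealVec_neg`, `conj_feynSym_ofRealVec_neg` ⟹ REALITY `im_PinfKer`,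
  `PinfKer_eq_re`, `latticeKernel_feynSym_eq_re`.
* §3 `integrableOn_integrand_symP_mul_feynSym` ∕ `…_feynSym_mul_symP` (integrable × continuous on the compact zone) and the kernel identities
  **`latticeKernel_sum_symP_mul_feynSym`**, **`latticeKernel_sum_feynSym_mul_symP`**: `K[Σ_γ …](w) = [w = 0 ∧ α = β]` (§1's `latticeKernel_congr_off_zero` + `FibreInverseDecay.latticeKernel_const`).
DICTIONARY (prose, not restated): by `PerfectMaxwellDictMatrix.deltaZLim_eq_re_integral_maxwellMat` the real kernel of `bondSymbol GsymInf` is Bałaban's perfect effective Laplacian `Δ_∞`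
(`GAN24/EffectiveLaplacianLimit.deltaZLim`) in the bond basis, so `Re K[feynSym]` = `Δ_∞` + the `ξ = 1` slice `d d*` up to that dictionary's `(x − z)` orientation.
Provenance: G-an2-4 formalisation swarm seat b2b-balaban-gan24-formalise-leaf-02 gen 40 (prover-b2b-balaban-gan24-formalise-leaf-02-g40-0; cross-lane on road FP under R-FP-33 (c),
sub-row H2-P-INVKER of H2-ASM-5a, first refusal this lineage, owner b2b-balaban-beta-d1-p3 l.26457), 2026-08-21.
-/

noncomputable section

namespace Summit.QuantumFields.BalabanUV.Beta.FP.PerfectFeynmanSymbol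

open MeasureTheory Complex Set Filter Topology Finset
open scoped Real BigOperators ComplexConjugate
open Literature.MathematicalPhysics.QuantumFieldTheory.Balaban1983to89
open B4Strip (ofRealVec Strip)
open B4ContourShift (BZ phase integrand fourierBox latticeKernel StripRegular supNorm latticeKernel_decay ofRealVec_mem_Strip norm_cexp_phase stripRegular_const
  continuous_ofRealVec)
open B5Symbol166Strip (expFacNeg expFacPos expFacNeg_ofReal expFacPos_ofReal stripRegular_expFacNeg stripRegular_expFacPos kappa166 kappa166_pos MW MW_pos)
open B5Prop11Fiber (d1Sym)
open Literature.MathematicalPhysics.QuantumFieldTheory.Balaban1983to89.Beta.FibreInverseDecay (latticeKernel_const)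
open Summit.QuantumFields.BalabanUV.Beta.GAN24.LatticeKernelReality (latticeKernel_im_eq_zero latticeKernel_eq_re ofRealVec_neg neg_mem_BZ_iff)
open Summit.QuantumFields.BalabanUV.Beta.GAN24.StripRegularRestrict (stripRegular_finset_sum)
open Summit.QuantumFields.BalabanUV.Beta.GAN24.DirichletExhaustionDeltaZ (dirI)
open Summit.QuantumFields.BalabanUV.Beta.FP.PerfectSymbol166 (W166Inf)
open Summit.QuantumFields.BalabanUV.Beta.FP.PerfectSymbol166StripReg (stripRegular_W166Inf)
open Summit.QuantumFields.BalabanUV.Beta.FP.PerfectSymbolKMultiplierClosed (GsymInf)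
open Summit.QuantumFields.BalabanUV.Beta.FP.PerfectMaxwellDict (bondSymbol)
open Summit.QuantumFields.BalabanUV.Beta.FP.PerfectMaxwellDictMatrix (bondSymbol_GsymInf_eq_maxwellMat)
open Summit.QuantumFields.BalabanUV.Beta.FP.PerfectPropagatorSymbol (feynMat PinfSym PinfSym_mul_feynMat feynMat_mul_PinfSym)
open Summit.QuantumFields.BalabanUV.Beta.FP.PerfectPropagatorKernel (symP symP_ofRealVec PinfKer integrableOn_integrand_symP)
open Summit.QuantumFields.BalabanUV.Beta.FP.PerfectPropagatorKernelSymm (PinfSym_neg W166Inf_neg d1Sym_neg feynMat_star)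
open Summit.QuantumFields.BalabanUV.Beta.FP.PerfectPropagatorBound (d1Sym_ne_zero)
open Summit.QuantumFields.BalabanUV.Beta.FP.CoarseCovarianceInverseKernel (tsum_latticeKernel_mul_of_integrableOn tsum_latticeKernel_mul_of_integrableOn'
  summable_latticeKernel_mul_of_stripRegular)

variable {d : ℕ}

/-! ## §1 [folklore] Two-point corollaries of the `L¹` convolution theorem and the punctured-zone congruence -/

section TwoPoint

/-- [folklore] TWO-POINT FORM, integrable factor on the LEFT: for `P` zone-integrable and `S` strip regular (`κ > 0`),
`Σ'_y K[P](y − x)·K[S](z − y) = K[P·S](z − x)` (`CoarseCovarianceInverseKernel.tsum_latticeKernel_mul_of_integrableOn` re-indexed `w = y − x`). -/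
theorem tsum_latticeKernel_mul_sub_of_integrable {P S : (Fin (d + 1) → ℂ) → ℂ} {κ MS : ℝ}
    (hP : IntegrableOn (fun p => P (ofRealVec p)) (BZ (d + 1))) (hS : StripRegular S κ MS) (hκ : 0 < κ) (x z : Fin (d + 1) → ℤ) :
    ∑' y, latticeKernel P (y - x) * latticeKernel S (z - y) = latticeKernel (fun p => P p * S p) (z - x) := by
  have h := tsum_latticeKernel_mul_of_integrableOn hS hκ hP (z - x)
  have e : (fun p => S p * P p) = fun p => P p * S p := by funext p; ring
  rw [e] at h
  rw [← h]
  conv_rhs => rw [← (Equiv.subRight x).tsum_eq]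
  refine tsum_congr fun y => ?_
  simp only [Equiv.subRight_apply]
  rw [mul_comm]
  congr 2
  abel

/-- [folklore] TWO-POINT FORM, integrable factor on the RIGHT: `Σ'_y K[S](y − x)·K[P](z − y) = K[S·P](z − x)`. -/
theorem tsum_latticeKernel_mul_sub_of_integrable' {P S : (Fin (d + 1) → ℂ) → ℂ} {κ MS : ℝ}
    (hP : IntegrableOn (fun p => P (ofRealVec p)) (BZ (d + 1))) (hS : StripRegular S κ MS) (hκ : 0 < κ) (x z : Fin (d + 1) → ℤ) :
    ∑' y, latticeKernel S (y - x) * latticeKernel P (z - y) = latticeKernel (fun p => S p * P p) (z - x) := by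
  have h := tsum_latticeKernel_mul_of_integrableOn' hS hκ hP (z - x)
  have e : (fun p => P p * S p) = fun p => S p * P p := by funext p; ring
  rw [e] at h
  rw [← h]
  conv_rhs => rw [← (Equiv.subRight x).tsum_eq]
  refine tsum_congr fun y => ?_
  simp only [Equiv.subRight_apply]
  rw [mul_comm]
  congr 2
  abel

/-- [folklore] summability of both two-point summands (strip-regular kernel exponentially decaying × ANY lattice kernel, `summable_latticeKernel_mul_of_stripRegular`). -/
theorem summable_latticeKernel_mul_sub_of_integrable (P : (Fin (d + 1) → ℂ) → ℂ) {S : (Fin (d + 1) → ℂ) → ℂ} {κ MS : ℝ}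
    (hS : StripRegular S κ MS) (hκ : 0 < κ) (x z : Fin (d + 1) → ℤ) :
    Summable (fun y => latticeKernel P (y - x) * latticeKernel S (z - y)) ∧
      Summable (fun y => latticeKernel S (y - x) * latticeKernel P (z - y)) := by
  constructor
  · have h := summable_latticeKernel_mul_of_stripRegular (C := P) hS hκ (z - x)
    have h2 : Summable fun y => latticeKernel S (z - x - (y - x)) * latticeKernel P (y - x) := by
      simpa [Function.comp_def] using (Equiv.subRight x).summable_iff.mpr h
    refine h2.congr fun y => ?_
    rw [mul_comm]
    congr 2
    abel
  · have h := summable_latticeKernel_mul_of_stripRegular (C := P) hS hκ (z - x)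
    have h2 : Summable fun y => latticeKernel S (z - x - (z - y)) * latticeKernel P (z - y) := by
      simpa [Function.comp_def] using (Equiv.subLeft z).summable_iff.mpr h
    refine h2.congr fun y => ?_
    congr 2
    abel

/-- [folklore] a.e. congruence: symbols agreeing on the PUNCTURED real zone have the same lattice kernel (`{0}` is Lebesgue-null). -/
theorem latticeKernel_congr_off_zero {G₁ G₂ : (Fin (d + 1) → ℂ) → ℂ}
    (h : ∀ s ∈ BZ (d + 1), s ≠ 0 → G₁ (ofRealVec s) = G₂ (ofRealVec s)) (x : Fin (d + 1) → ℤ) :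
    latticeKernel G₁ x = latticeKernel G₂ x := by
  unfold latticeKernel fourierBox
  congr 1
  refine setIntegral_congr_ae measurableSet_Icc ?_
  have h0 : (volume : Measure (Fin (d + 1) → ℝ)) {0} = 0 := measure_singleton 0
  filter_upwards [compl_mem_ae_iff.mpr h0] with s hs0 hs
  unfold integrand
  rw [h s hs hs0]

/-- [our object] the propagator symbol entries read on the real zone are zone-integrable (`3 ≤ d + 1`; `integrableOn_integrand_symP` at `x = 0`). -/
theorem integrableOn_symP_ofRealVec (hd : 3 ≤ d + 1) (α β : Fin (d + 1)) :
    IntegrableOn (fun p => symP α β (ofRealVec p)) (BZ (d + 1)) := by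
  refine (integrableOn_integrand_symP hd α β 0).congr_fun (fun p _ => ?_) measurableSet_Icc
  unfold integrand phase
  simp

end TwoPoint

/-! ## §2 The holomorphic Feynman entry symbol: strip regularity, real-zone dictionary, punctured-zone inverse, reality -/

section Symbols

/-- [our object] the holomorphic `ξ = 1` slice symbol entry `(e^{ip_γ} − 1)(e^{−ip_β} − 1)`. -/
def sliceSym (γ β : Fin (d + 1)) (p : Fin (d + 1) → ℂ) : ℂ := expFacPos γ p * expFacNeg β p

/-- [our object] the holomorphic Feynman entry symbol. -/
def feynSym (γ β : Fin (d + 1)) (p : Fin (d + 1) → ℂ) : ℂ := bondSymbol GsymInf γ β p + sliceSym γ β p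

/-- [our object] the defining formula of `feynSym`. -/
theorem feynSym_def (γ β : Fin (d + 1)) (p : Fin (d + 1) → ℂ) : feynSym γ β p = bondSymbol GsymInf γ β p + sliceSym γ β p := rfl

/-- [our object] strip regularity of the closed-form entry symbol `GsymInf` (μ ≠ ν). -/
theorem stripRegular_GsymInf {κ : ℝ} (hκ0 : 0 ≤ κ) (hκ : κ ≤ kappa166 (d + 1)) {μ ν : Fin (d + 1)} (hμν : μ ≠ ν) (a b : Fin (d + 1)) :
    StripRegular (d := d) (GsymInf μ ν a b) κ (‖(1 / 2 : ℂ)‖ * MW (d + 1) * ((Real.exp κ + 1) * (Real.exp κ + 1))) := by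
  have h1 := stripRegular_const (d := d) (1 / 2 : ℂ) κ
  have hW := stripRegular_W166Inf (d := d) hκ0 hκ hμν
  have hE := (stripRegular_expFacNeg (d := d) a κ).mul (stripRegular_expFacPos (d := d) b κ) (by positivity)
  have h := (h1.mul hW (norm_nonneg _)).mul hE (mul_nonneg (norm_nonneg _) (MW_pos _).le)
  exact h

/-- [our object] strip regularity of the bond-basis symbol of `Δ_∞` (some bound). -/
theorem exists_stripRegular_bondSymbol_GsymInf {κ : ℝ} (hκ0 : 0 ≤ κ) (hκ : κ ≤ kappa166 (d + 1)) (γ β : Fin (d + 1)) :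
    ∃ M, 0 ≤ M ∧ StripRegular (d := d) (bondSymbol GsymInf γ β) κ M := by
  classical
  set B : ℝ := ‖(1 / 2 : ℂ)‖ * MW (d + 1) * ((Real.exp κ + 1) * (Real.exp κ + 1)) with hB
  have hB0 : 0 ≤ B := by rw [hB]; have := MW_pos (d + 1); positivity
  -- one coefficient term
  have hterm : ∀ (c : ℝ) {μ ν : Fin (d + 1)} (hμν : μ ≠ ν) (a b : Fin (d + 1)), |c| ≤ 1 →
      StripRegular (d := d) (fun p => ((c : ℝ) : ℂ) * GsymInf μ ν a b p) κ (1 * B) := by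
    intro c μ ν hμν a b hc
    have h := ((stripRegular_const (d := d) ((c : ℝ) : ℂ) κ).mul (stripRegular_GsymInf hκ0 hκ hμν a b) (norm_nonneg _))
    refine h.mono ?_
    refine mul_le_mul_of_nonneg_right ?_ hB0
    rw [Complex.norm_real, Real.norm_eq_abs]; exact hc
  have hdir : ∀ i j k l : Fin (d + 1), |dirI i j * dirI k l| ≤ 1 := by
    intro i j k l; unfold dirI; split_ifs <;> simp
  refine ⟨∑ _μ : Fin (d + 1), ∑ _ν : Fin (d + 1), (4 : ℝ) * B, by positivity, ?_⟩
  show StripRegular (fun p => ∑ μ : Fin (d + 1), ∑ ν : Fin (d + 1), (if μ = ν then 0 else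
    ((((dirI ν γ * dirI ν β : ℝ)) : ℂ) * GsymInf μ ν μ μ p - (((dirI ν γ * dirI μ β : ℝ)) : ℂ) * GsymInf μ ν μ ν p
      - (((dirI μ γ * dirI ν β : ℝ)) : ℂ) * GsymInf μ ν ν μ p + (((dirI μ γ * dirI μ β : ℝ)) : ℂ) * GsymInf μ ν ν ν p))) κ _
  refine stripRegular_finset_sum Finset.univ fun μ _ => stripRegular_finset_sum Finset.univ fun ν _ => ?_
  by_cases h : μ = ν
  · have h0 := stripRegular_const (d := d) (0 : ℂ) κ
    rw [norm_zero] at h0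
    simp only [h, if_true]
    exact h0.mono (by positivity)
  · have t1 := hterm (dirI ν γ * dirI ν β) h μ μ (hdir _ _ _ _)
    have t2 := hterm (-(dirI ν γ * dirI μ β)) h μ ν (by rw [abs_neg]; exact hdir _ _ _ _)
    have t3 := hterm (-(dirI μ γ * dirI ν β)) h ν μ (by rw [abs_neg]; exact hdir _ _ _ _)
    have t4 := hterm (dirI μ γ * dirI μ β) h ν ν (hdir _ _ _ _)
    have hs := ((t1.add t2).add t3).add t4
    simp only [h, if_false]
    convert hs using 1
    · funext p; push_cast; ring
    · ring

/-- [our object] strip regularity of the holomorphic Feynman entry symbol on the (1.66) strip. -/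
theorem exists_stripRegular_feynSym (γ β : Fin (d + 1)) :
    ∃ M, 0 ≤ M ∧ StripRegular (d := d) (feynSym γ β) (kappa166 (d + 1)) M := by
  obtain ⟨M, hM0, hM⟩ := exists_stripRegular_bondSymbol_GsymInf (d := d) (kappa166_pos (d + 1)).le le_rfl γ β
  have hsl : StripRegular (d := d) (sliceSym γ β) (kappa166 (d + 1)) ((Real.exp (kappa166 (d + 1)) + 1) * (Real.exp (kappa166 (d + 1)) + 1)) :=
    (stripRegular_expFacPos (d := d) γ _).mul (stripRegular_expFacNeg (d := d) β _) (by positivity)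
  exact ⟨_, by positivity, hM.add hsl⟩

/-- [our object] ON THE REAL ZONE the holomorphic symbol IS the owner's Feynman matrix entry. -/
theorem feynSym_ofReal {s : Fin (d + 1) → ℝ} (hs : s ∈ BZ (d + 1)) (γ β : Fin (d + 1)) :
    feynSym γ β (ofRealVec s) = feynMat (fun μ ν => (W166Inf μ ν (ofRealVec s)).re) (d1Sym s) γ β := by
  rw [feynSym_def, bondSymbol_GsymInf_eq_maxwellMat hs γ β]
  unfold feynMat sliceSym
  rw [expFacPos_ofReal, expFacNeg_ofReal]

/-- [our object] on the punctured real zone: `Σ_γ symP α γ · feynSym γ β = [α = β]`. -/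
theorem sum_symP_mul_feynSym {s : Fin (d + 1) → ℝ} (hs : s ∈ BZ (d + 1)) (h0 : s ≠ 0) (α β : Fin (d + 1)) :
    ∑ γ, symP α γ (ofRealVec s) * feynSym γ β (ofRealVec s) = if α = β then 1 else 0 := by
  have h := PinfSym_mul_feynMat hs (d1Sym_ne_zero hs h0)
  have h2 := congr_fun (congr_fun h α) β
  rw [Matrix.mul_apply, Matrix.one_apply] at h2
  simp_rw [symP_ofRealVec, feynSym_ofReal hs]
  exact h2

/-- [our object] … and `Σ_γ feynSym α γ · symP γ β = [α = β]`. -/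
theorem sum_feynSym_mul_symP {s : Fin (d + 1) → ℝ} (hs : s ∈ BZ (d + 1)) (h0 : s ≠ 0) (α β : Fin (d + 1)) :
    ∑ γ, feynSym α γ (ofRealVec s) * symP γ β (ofRealVec s) = if α = β then 1 else 0 := by
  have h := feynMat_mul_PinfSym hs (d1Sym_ne_zero hs h0)
  have h2 := congr_fun (congr_fun h α) β
  rw [Matrix.mul_apply, Matrix.one_apply] at h2
  simp_rw [symP_ofRealVec, feynSym_ofReal hs]
  exact h2

/-- [our object] conjugation symmetry of `symP` on the real zone. -/
theorem conj_symP_ofRealVec_neg (α β : Fin (d + 1)) (s : Fin (d + 1) → ℝ) :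
    conj (symP α β (ofRealVec (-s))) = symP α β (ofRealVec s) := by
  rw [symP_ofRealVec, symP_ofRealVec, PinfSym_neg, Matrix.map_apply, Complex.conj_conj]

/-- [our object] conjugation symmetry of `feynSym` on the real zone. -/
theorem conj_feynSym_ofRealVec_neg {s : Fin (d + 1) → ℝ} (hs : s ∈ BZ (d + 1)) (γ β : Fin (d + 1)) :
    conj (feynSym γ β (ofRealVec (-s))) = feynSym γ β (ofRealVec s) := by
  rw [feynSym_ofReal ((neg_mem_BZ_iff s).mpr hs), feynSym_ofReal hs]
  have hw : (fun μ ν => (W166Inf μ ν (ofRealVec (-s))).re) = fun μ ν => (W166Inf μ ν (ofRealVec s)).re := by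
    funext μ ν; rw [ofRealVec_neg, W166Inf_neg]
  rw [hw, d1Sym_neg, feynMat_star, Matrix.map_apply, Complex.conj_conj]

/-- [our object] `PinfKer` is real. -/
theorem im_PinfKer (α β : Fin (d + 1)) (z : Fin (d + 1) → ℤ) : (PinfKer α β z).im = 0 :=
  latticeKernel_im_eq_zero (G := symP α β) (fun s _ => conj_symP_ofRealVec_neg α β s) z

/-- [our object] `PinfKer = ↑(Re PinfKer)`. -/
theorem PinfKer_eq_re (α β : Fin (d + 1)) (z : Fin (d + 1) → ℤ) : PinfKer α β z = ((((PinfKer α β z).re : ℝ)) : ℂ) :=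
  latticeKernel_eq_re (G := symP α β) (fun s _ => conj_symP_ofRealVec_neg α β s) z

/-- [our object] the Feynman kernel is real. -/
theorem latticeKernel_feynSym_eq_re (γ β : Fin (d + 1)) (z : Fin (d + 1) → ℤ) :
    latticeKernel (feynSym γ β) z = ((((latticeKernel (feynSym γ β) z).re : ℝ)) : ℂ) :=
  latticeKernel_eq_re (G := feynSym γ β) (fun _ hs => conj_feynSym_ofRealVec_neg hs γ β) z

/-! ## §3 The punctured-zone identities read on the kernels -/

/-- [our object] integrability of the product integrand `symP α γ · feynSym γ β` on the zone (`3 ≤ d + 1`). -/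
theorem integrableOn_integrand_symP_mul_feynSym (hd : 3 ≤ d + 1) (α γ β : Fin (d + 1)) (x : Fin (d + 1) → ℤ) :
    IntegrableOn (integrand (fun p => symP α γ p * feynSym γ β p) x) (BZ (d + 1)) := by
  obtain ⟨M, _, hM⟩ := exists_stripRegular_feynSym (d := d) γ β
  have hc : ContinuousOn (fun s => feynSym γ β (ofRealVec s)) (BZ (d + 1)) :=
    hM.cont.comp continuous_ofRealVec.continuousOn fun p hp => ofRealVec_mem_Strip (kappa166_pos _).le hp
  have h := (integrableOn_integrand_symP hd α γ x).mul_continuousOn hc isCompact_Icc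
  refine h.congr_fun (fun s _ => ?_) measurableSet_Icc
  unfold integrand; ring

/-- [our object] integrability of the product integrand `feynSym α γ · symP γ β` on the zone (`3 ≤ d + 1`). -/
theorem integrableOn_integrand_feynSym_mul_symP (hd : 3 ≤ d + 1) (α γ β : Fin (d + 1)) (x : Fin (d + 1) → ℤ) :
    IntegrableOn (integrand (fun p => feynSym α γ p * symP γ β p) x) (BZ (d + 1)) := by
  obtain ⟨M, _, hM⟩ := exists_stripRegular_feynSym (d := d) α γ
  have hc : ContinuousOn (fun s => feynSym α γ (ofRealVec s)) (BZ (d + 1)) :=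
    hM.cont.comp continuous_ofRealVec.continuousOn fun p hp => ofRealVec_mem_Strip (kappa166_pos _).le hp
  have h := IntegrableOn.continuousOn_mul hc (integrableOn_integrand_symP hd γ β x) isCompact_Icc
  refine h.congr_fun (fun s _ => ?_) measurableSet_Icc
  unfold integrand; ring

/-- [our object] **THE KERNEL OF `Σ_γ symP α γ · feynSym γ β` IS `[α = β]·δ`**: `K[Σ_γ symP α γ · feynSym γ β](w) = [w = 0 ∧ α = β]`. -/
theorem latticeKernel_sum_symP_mul_feynSym (α β : Fin (d + 1)) (w : Fin (d + 1) → ℤ) :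
    latticeKernel (fun p => ∑ γ, symP α γ p * feynSym γ β p) w = if w = 0 ∧ α = β then 1 else 0 := by
  rw [latticeKernel_congr_off_zero (G₂ := fun _ => if α = β then (1 : ℂ) else 0)
    (fun s hs h0 => by simpa only using sum_symP_mul_feynSym hs h0 α β) w, latticeKernel_const]
  by_cases h1 : w = 0 <;> by_cases h2 : α = β <;> simp [h1, h2]

/-- [our object] … and `K[Σ_γ feynSym α γ · symP γ β](w) = [w = 0 ∧ α = β]`. -/
theorem latticeKernel_sum_feynSym_mul_symP (α β : Fin (d + 1)) (w : Fin (d + 1) → ℤ) :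
    latticeKernel (fun p => ∑ γ, feynSym α γ p * symP γ β p) w = if w = 0 ∧ α = β then 1 else 0 := by
  rw [latticeKernel_congr_off_zero (G₂ := fun _ => if α = β then (1 : ℂ) else 0)
    (fun s hs h0 => by simpa only using sum_feynSym_mul_symP hs h0 α β) w, latticeKernel_const]
  by_cases h1 : w = 0 <;> by_cases h2 : α = β <;> simp [h1, h2]

end Symbols

end Summit.QuantumFields.BalabanUV.Beta.FP.PerfectFeynmanSymbol

end
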